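import Summits.QuantumFields.YangMills.Theorems.PencilRigidityWeakCouplingHypercubicLimitFieldObsExpectation
import Summits.QuantumFields.YangMills.Theorems.PencilRigidityWeakCouplingHypercubicLimitPlaneDistTendsto
import Summits.QuantumFields.YangMills.Theorems.PencilRigidityWeakCouplingHypercubicLimitThermalBookkeeping
import Summits.QuantumFields.YangMills.Theorems.PencilRigidityWeakCouplingHypercubicLimitReflectedTensor
import Summits.QuantumFields.YangMills.Theorems.LangevinControlUVOSLegsAtWeakCouplingCStubClusterFrame
import Summits.QuantumFields.YangMills.Theorems.LangevinControlUVOSLegsFromFemtoAndGapStubAssemblyRPLimit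
import Literature.MathematicalPhysics.QuantumFieldTheory.SchwingerLimitInheritance
import Literature.MathematicalPhysics.QuantumLattice.SchwartzTranslationCutoff
import HarnessLib

/-!
# Crux `WeakCouplingHypercubicLimit` (stmt-QuantumFields-16120), line `Sketch`, r10: the lattice → continuum transfer of the
# reflection pairing (toolkit for `stub_decayOfRPSpectral` / `stub_rpPosOfPlaneLimits`)

Along a `PlaneLimits r sch φ T` package with the `k`-uniform functional bound, for a test function `F` supported at
`δ`-SEPARATED points with times in `[τ, ρ]` (the dense class of `separatedDensity_of_isOffDiagonal`), the torus reflection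
pairing of the smeared renormalised functionals of `F` and of a translate `T_{v_k} F'` of a positive-time separated `F'`
converges to the continuum OS pairing of the limit family `planeSum T`:
`E_k[conj Φ_k(F)(ΘU) · Φ_k(T_{v_k} F')(U)] → planeSum T (n+n') (ΘF* ⊗ T_{v₀} F')` (`tendsto_rpPair`) — the lattice
side is an EXACT finite sum of `planeDist`'s of the reflected, slot-wise `O(a_k)`-shifted test function
(`rpPair_eq_sum_planeDist`), which stays in `⁰𝒮` and converges in `𝓢` (`reflectedTensor_facts`), so the moving-test-function
limit lemma `planeDist_tendsto_of_tendsto` applies.  Consequences: the mean converges (`tendsto_mean`), and hermiticity of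
the limit on the separated class (`planeSum_osAdjoint_eq_conj`, from the arity-`(n,0)` pairing and the `Θ`-invariance of
Wilson's torus state).

Refs: OsterwalderSeiler1978 §§2–3; OsterwalderSchrader1973 §2, §4.
-/

noncomputable section

open scoped SchwartzMap BigOperators ComplexConjugate
open MeasureTheory Filter Topology
open Literature.MathematicalPhysics.QuantumFieldTheory Literature.MathematicalPhysics.QuantumLattice
open Literature.MathematicalPhysics.AQFT
open Literature.Probability.LatticeModels (box Site)
open Summit.QuantumFields.YangMills.Cruxes.HypercubicLimit.CouplingResponse
open Summit.QuantumFields.YangMills.Cruxes.OSLegsFromFemtoAndGap.DlrCollarTransfer (plane conn Decay RPPos ConnCS)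
open Summit.QuantumFields.YangMills.Cruxes.OSLegsAtWeakCouplingC.Sketch (Separated)
open Summit.QuantumFields.YangMills.Theorems.OSLegsFromFemtoAndGap

namespace Summit.QuantumFields.YangMills.Theorems.WeakCouplingHypercubicLimit.TraceNormColdPressure


variable {G : Type} [Group G] [TopologicalSpace G] [IsTopologicalGroup G] [CompactSpace G]
  [MeasurableSpace G] [BorelSpace G]

/-! ### Small kinematics -/

omit [IsTopologicalGroup G] [CompactSpace G] [BorelSpace G] in
/-- The smeared functional of the constant `1` of arity `0` is the constant `1`. [folklore] -/
theorem fieldObs_constOne (r : LatticeRep G) (L : ℕ) (a : ℝ) (m : Fin 4 × Fin 4 → ℝ) (U : GaugeConfig 4 (2 * L + 1) G) :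
    fieldObs r L a (SchwartzMap.constOfSubsingleton (D := Fin 0 → EuclideanSpace ℝ (Fin 4)) (1 : ℂ)) m U = 1 := by
  unfold fieldObs strObs
  simp [Fintype.piFinset_of_isEmpty, SchwartzMap.constOfSubsingleton_apply]

/-- Tensoring with the constant `1` of arity `0` is the identity (`Fin (n + 0) = Fin n` definitionally). [folklore] -/
theorem appendTensor_constOne_eq {n : ℕ} (F : 𝓢((Fin n → EuclideanSpace ℝ (Fin 4)), ℂ)) :
    (F.appendTensor (SchwartzMap.constOfSubsingleton (D := Fin 0 → EuclideanSpace ℝ (Fin 4)) (1 : ℂ)) :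
      𝓢((Fin (n + 0) → EuclideanSpace ℝ (Fin 4)), ℂ)) = F := by
  ext x
  rw [SchwartzMap.appendTensor_apply, SchwartzMap.constOfSubsingleton_apply, mul_one]
  congr 1

/-- `planeSum T (n + 0) (F ⊗ 1) = planeSum T n F`. [folklore] -/
theorem planeSum_appendTensor_constOne {n : ℕ}
    (T : (n : ℕ) → (Fin n → Plane) → (𝓢((Fin n → EuclideanSpace ℝ (Fin 4)), ℂ) →L[ℂ] ℂ))
    (F : 𝓢((Fin n → EuclideanSpace ℝ (Fin 4)), ℂ)) :
    planeSum T (n + 0) (F.appendTensor (SchwartzMap.constOfSubsingleton (D := Fin 0 → EuclideanSpace ℝ (Fin 4)) (1 : ℂ))) =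
      planeSum T n F := by
  rw [appendTensor_constOne_eq]
  rfl

/-- Translation by `0` is the identity. [folklore] -/
theorem translateMulti_zero_eq {n : ℕ} (F : 𝓢((Fin n → EuclideanSpace ℝ (Fin 4)), ℂ)) :
    translateMulti (0 : EuclideanSpace ℝ (Fin 4)) F = F := by
  ext x; simp

/-- The constant `1` of arity `0` is supported at positive, pairwise distinct points (vacuously). [folklore] -/
theorem tsupport_constOne_subset_posSep :
    tsupport ((SchwartzMap.constOfSubsingleton (D := Fin 0 → EuclideanSpace ℝ (Fin 4)) (1 : ℂ) :
        𝓢((Fin 0 → EuclideanSpace ℝ (Fin 4)), ℂ)) : (Fin 0 → EuclideanSpace ℝ (Fin 4)) → ℂ) ⊆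
      {v | (∀ l, 0 < v l 0) ∧ Function.Injective v} :=
  fun v _ => ⟨fun l => l.elim0, Function.injective_of_subsingleton v⟩

/-- A test function supported at `δ`-separated points (`δ > 0`) with times `≥ τ > 0` is supported at positive, pairwise
distinct points. [folklore] -/
theorem posSep_of_separated {n : ℕ} {F : 𝓢((Fin n → EuclideanSpace ℝ (Fin 4)), ℂ)} {δ τ : ℝ} (hδ : 0 < δ)
    (hτ : 0 < τ) (hFδ : tsupport (F : (Fin n → EuclideanSpace ℝ (Fin 4)) → ℂ) ⊆ Separated n δ)
    (hFτ : tsupport (F : (Fin n → EuclideanSpace ℝ (Fin 4)) → ℂ) ⊆ {u | ∀ l, τ ≤ u l 0}) :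
    tsupport (F : (Fin n → EuclideanSpace ℝ (Fin 4)) → ℂ) ⊆ {v | (∀ l, 0 < v l 0) ∧ Function.Injective v} := by
  intro u hu
  refine ⟨fun l => lt_of_lt_of_le hτ (hFτ hu l), fun i j hij => ?_⟩
  by_contra hne
  have h := hFδ hu i j hne
  rw [hij, dist_self] at h
  linarith

/-- The slot-wise time shifts of the reflected test function have size at most the lattice spacing. [folklore] -/
theorem norm_shiftVec_le {n n' : ℕ} {a : ℝ} (ha : 0 ≤ a) (Q : Fin (n + n') → Plane) (l : Fin n) :
    ‖-((a * (1 - if (Q (Fin.castAdd n' (Fin.rev l))).1.1 = 0 then 1 else 0)) •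
        siteToE (Pi.single (0 : Fin 4) (1 : ℤ)))‖ ≤ a := by
  rw [norm_neg, norm_smul, norm_siteToE_single, mul_one, Real.norm_eq_abs]
  split_ifs <;> simp [abs_of_nonneg ha, ha]

/-- The vanishing hypothesis of the reindexing step: `F u = 0` as soon as some slot has time `≤ 0` or `> ρ`. [folklore] -/
theorem apply_eq_zero_of_time {n : ℕ} {F : 𝓢((Fin n → EuclideanSpace ℝ (Fin 4)), ℂ)} {ρ τ : ℝ} (hτ : 0 < τ)
    (hFρ : tsupport (F : (Fin n → EuclideanSpace ℝ (Fin 4)) → ℂ) ⊆ Metric.closedBall 0 ρ)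
    (hFτ : tsupport (F : (Fin n → EuclideanSpace ℝ (Fin 4)) → ℂ) ⊆ {u | ∀ l, τ ≤ u l 0}) :
    ∀ u : Fin n → EuclideanSpace ℝ (Fin 4), (∃ l, u l 0 ≤ 0 ∨ ρ < u l 0) → F u = 0 := by
  intro u hu
  by_contra hne
  have hmem : u ∈ tsupport (F : (Fin n → EuclideanSpace ℝ (Fin 4)) → ℂ) := subset_tsupport _ (Function.mem_support.2 hne)
  obtain ⟨l, hl | hl⟩ := hu
  · linarith [hFτ hmem l]
  · have hball := hFρ hmem
    rw [Metric.mem_closedBall, dist_zero_right] at hball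
    have h1 : |u l 0| ≤ ‖u l‖ := by
      simpa [Real.norm_eq_abs] using (PiLp.norm_apply_le (u l) 0 : ‖u l 0‖ ≤ ‖u l‖)
    have h2 : ‖u l‖ ≤ ‖u‖ := norm_le_pi_norm u l
    linarith [le_abs_self (u l 0)]

/-! ### The transfer of the reflection pairing -/

section Transfer

variable (r : LatticeRep G) (sch : SpeciesScheme (YMSpecies G)) (φ : ℕ → ℕ) (hφ : StrictMono φ)
  (T : (n : ℕ) → (Fin n → Plane) → (𝓢((Fin n → EuclideanSpace ℝ (Fin 4)), ℂ) →L[ℂ] ℂ))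
  (hUFB : UniformFunctionalBoundPlanes r sch) (hPL : PlaneLimits r sch φ T)
  {n : ℕ} {F : 𝓢((Fin n → EuclideanSpace ℝ (Fin 4)), ℂ)} {ρ τ δ : ℝ} (hτ : 0 < τ) (hδ : 0 < δ)
  (hFρ : tsupport (F : (Fin n → EuclideanSpace ℝ (Fin 4)) → ℂ) ⊆ Metric.closedBall 0 ρ)
  (hFτ : tsupport (F : (Fin n → EuclideanSpace ℝ (Fin 4)) → ℂ) ⊆ {u | ∀ l, τ ≤ u l 0})
  (hFδ : tsupport (F : (Fin n → EuclideanSpace ℝ (Fin 4)) → ℂ) ⊆ Separated n δ)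

include hφ hUFB hPL hτ hδ hFρ hFτ hFδ

/-- **The transfer of the reflection pairing.**  For a positive-time separated `F'`, translation vectors `v k → v₀` with
non-negative time components, and along the subsequence `φ`:
`E_{φk}[conj Φ(F)(ΘU) · Φ(T_{v_k} F')(U)] → planeSum T (n+n') (ΘF* ⊗ T_{v₀} F')` (renormalised smearings
`(c a⁴)ⁿ • F`, common counterterm `m_k/6`). [folklore] -/
theorem tendsto_rpPair {n' : ℕ} (F' : 𝓢((Fin n' → EuclideanSpace ℝ (Fin 4)), ℂ))
    (hF' : tsupport (F' : (Fin n' → EuclideanSpace ℝ (Fin 4)) → ℂ) ⊆ {v | (∀ l, 0 < v l 0) ∧ Function.Injective v})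
    (v : ℕ → EuclideanSpace ℝ (Fin 4)) (v₀ : EuclideanSpace ℝ (Fin 4)) (hv : Tendsto v atTop (𝓝 v₀))
    (hv0 : ∀ k, 0 ≤ v k 0) :
    Tendsto (fun k => ∫ U, conj (fieldObs r (sch.L (φ k)) (sch.a (φ k))
            ((((sch.c r.curvature (φ k) * sch.a (φ k) ^ 4) ^ n : ℝ) : ℂ) • F) (fun _ => sch.m r.curvature (φ k) / 6)
            (GaugeConfig.timeReflect U)) *
          fieldObs r (sch.L (φ k)) (sch.a (φ k))
            ((((sch.c r.curvature (φ k) * sch.a (φ k) ^ 4) ^ n' : ℝ) : ℂ) • translateMulti (v k) F')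
            (fun _ => sch.m r.curvature (φ k) / 6) U
        ∂(wilsonMeasure r.ρ (sch.β (φ k)) : Measure (GaugeConfig 4 (2 * sch.L (φ k) + 1) G)))
      atTop (𝓝 (planeSum T (n + n') ((osAdjoint F).appendTensor (translateMulti v₀ F')))) := by
  classical
  -- eventually the spacing is small and the box large
  have ha0 : Tendsto (fun k => sch.a (φ k)) atTop (𝓝 0) := sch.tendsto_a.comp hφ.tendsto_atTop
  have haL : Tendsto (fun k => sch.a (φ k) * sch.L (φ k)) atTop atTop := sch.tendsto_L.comp hφ.tendsto_atTop
  have hsmall : ∀ᶠ k in atTop, 2 * sch.a (φ k) < δ ∧ sch.a (φ k) < τ ∧ ρ < sch.a (φ k) * sch.L (φ k) := by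
    have h1 : ∀ᶠ k in atTop, sch.a (φ k) < min (δ / 2) τ :=
      ha0.eventually (gt_mem_nhds (lt_min (by linarith) hτ))
    have h2 : ∀ᶠ k in atTop, ρ < sch.a (φ k) * sch.L (φ k) := haL.eventually (eventually_gt_atTop ρ)
    filter_upwards [h1, h2] with k hk1 hk2
    exact ⟨by linarith [lt_min_iff.1 hk1 |>.1], (lt_min_iff.1 hk1).2, hk2⟩
  -- the shift vectors and the moving test functions
  set d : ℕ → (Fin (n + n') → Plane) → Fin n → EuclideanSpace ℝ (Fin 4) := fun k Q l =>
    -((sch.a (φ k) * (1 - if (Q (Fin.castAdd n' (Fin.rev l))).1.1 = 0 then 1 else 0)) •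
      siteToE (Pi.single (0 : Fin 4) (1 : ℤ))) with hd
  set H₀ : 𝓢((Fin (n + n') → EuclideanSpace ℝ (Fin 4)), ℂ) := (osAdjoint F).appendTensor (translateMulti v₀ F') with hH₀
  set H : ℕ → (Fin (n + n') → Plane) → 𝓢((Fin (n + n') → EuclideanSpace ℝ (Fin 4)), ℂ) := fun k Q =>
    if 2 * sch.a (φ k) < δ ∧ sch.a (φ k) < τ then
      (osAdjoint (SchwartzMap.compSubConstCLM ℂ (d k Q) F)).appendTensor (translateMulti (v k) F')
    else H₀ with hH
  have hFps : tsupport (F : (Fin n → EuclideanSpace ℝ (Fin 4)) → ℂ) ⊆ {v | (∀ l, 0 < v l 0) ∧ Function.Injective v} :=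
    posSep_of_separated hδ hτ hFδ hFτ
  have hv₀0 : 0 ≤ v₀ 0 :=
    ge_of_tendsto (((EuclideanSpace.proj (0 : Fin 4)).continuous.tendsto v₀).comp hv) (Eventually.of_forall hv0)
  have hH₀off : IsOffDiagonal H₀ :=
    isOffDiagonal_appendTensor_osAdjoint_of_posSep hFps (posSep_translateMulti hF' hv₀0)
  have hHoff : ∀ k Q, IsOffDiagonal (H k Q) := by
    intro k Q
    simp only [hH]
    split_ifs with hk
    · exact reflectedTensor_facts.1 n n' F (translateMulti (v k) F') δ τ (sch.a (φ k)) (d k Q) hτ hFδ hFτ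
        (posSep_translateMulti hF' (hv0 k)) (fun l => norm_shiftVec_le (sch.a_pos (φ k)).le Q l) hk.1 hk.2
    · exact hH₀off
  have hdlim : ∀ Q, Tendsto (fun k => d k Q) atTop (𝓝 0) := by
    intro Q
    rw [tendsto_zero_iff_norm_tendsto_zero]
    refine squeeze_zero (fun k => norm_nonneg _) (fun k => ?_) ha0
    exact (pi_norm_le_iff_of_nonneg (sch.a_pos (φ k)).le).2 fun l => norm_shiftVec_le (sch.a_pos (φ k)).le Q l
  have hHlim : ∀ Q, Tendsto (fun k => H k Q) atTop (𝓝 H₀) := by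
    intro Q
    have h := reflectedTensor_facts.2 n n' F F' (fun k => d k Q) v v₀ (hdlim Q) hv
    refine h.congr' ?_
    filter_upwards [hsmall] with k hk
    simp only [hH, if_pos (And.intro hk.1 hk.2.1)]
  -- termwise limits and their sum
  have hsum : Tendsto (fun k => ∑ Q : Fin (n + n') → Plane, planeDist r sch (φ k) (n + n') Q (H k Q)) atTop
      (𝓝 (∑ Q : Fin (n + n') → Plane, T (n + n') Q H₀)) :=
    tendsto_finsetSum _ fun Q _ =>
      planeDist_tendsto_of_tendsto G r sch φ T hUFB hPL (n + n') Q (fun k => H k Q) H₀ (fun k => hHoff k Q) hH₀off (hHlim Q)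
  have hplaneSum : (∑ Q : Fin (n + n') → Plane, T (n + n') Q H₀) = planeSum T (n + n') H₀ := by
    unfold planeSum; rw [FunLike.coe_sum, Finset.sum_apply]
  rw [hplaneSum] at hsum
  refine hsum.congr' ?_
  filter_upwards [hsmall] with k hk
  rw [rpPair_eq_sum_planeDist G r sch (φ k) n n' F (translateMulti (v k) F') ρ
    (apply_eq_zero_of_time hτ hFρ hFτ) hk.2.2]
  refine Finset.sum_congr rfl fun Q _ => ?_
  simp only [hH, if_pos (And.intro hk.1 hk.2.1), hd]

omit hφ hUFB hFρ in
/-- **The mean converges**: `E_{φk}[Φ(F)] → planeSum T n F`. [folklore] -/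
theorem tendsto_mean :
    Tendsto (fun k => ∫ U, fieldObs r (sch.L (φ k)) (sch.a (φ k))
          ((((sch.c r.curvature (φ k) * sch.a (φ k) ^ 4) ^ n : ℝ) : ℂ) • F) (fun _ => sch.m r.curvature (φ k) / 6) U
        ∂(wilsonMeasure r.ρ (sch.β (φ k)) : Measure (GaugeConfig 4 (2 * sch.L (φ k) + 1) G)))
      atTop (𝓝 (planeSum T n F)) := by
  have hFo : IsOffDiagonal F := isOffDiagonal_of_posSep (posSep_of_separated hδ hτ hFδ hFτ)
  refine (hPL.tendsto_planeSum F hFo).congr' (Eventually.of_forall fun k => ?_)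
  exact ((fieldObs_expectation_facts G r).1 sch (φ k) n F).symm

/-- **Hermiticity of the limit on the separated class**: `planeSum T n (ΘF*) = conj (planeSum T n F)` — the arity-`(n,0)`
pairing `E[conj Φ(F)(ΘU) · 1]` converges to `planeSum T (n+0) (ΘF* ⊗ 1) = planeSum T n (ΘF*)` (`tendsto_rpPair`) and equals
`conj E[Φ(F)]` by the `Θ`-invariance of Wilson's torus state, which converges to `conj (planeSum T n F)`. [folklore] -/
theorem planeSum_osAdjoint_eq_conj : planeSum T n (osAdjoint F) = conj (planeSum T n F) := by
  set c1 : 𝓢((Fin 0 → EuclideanSpace ℝ (Fin 4)), ℂ) :=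
    SchwartzMap.constOfSubsingleton (D := Fin 0 → EuclideanSpace ℝ (Fin 4)) (1 : ℂ) with hc1
  -- the (n,0) pairing and its limit
  have h1 := tendsto_rpPair r sch φ hφ T hUFB hPL hτ hδ hFρ hFτ hFδ c1 tsupport_constOne_subset_posSep (fun _ => 0) 0
    tendsto_const_nhds (fun _ => le_rfl)
  rw [translateMulti_zero_eq, hc1, planeSum_appendTensor_constOne] at h1
  -- the same sequence is `conj E[Φ(F)]`
  have h2 : Tendsto (fun k => ∫ U, conj (fieldObs r (sch.L (φ k)) (sch.a (φ k))
            ((((sch.c r.curvature (φ k) * sch.a (φ k) ^ 4) ^ n : ℝ) : ℂ) • F) (fun _ => sch.m r.curvature (φ k) / 6)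
            (GaugeConfig.timeReflect U)) *
          fieldObs r (sch.L (φ k)) (sch.a (φ k))
            ((((sch.c r.curvature (φ k) * sch.a (φ k) ^ 4) ^ 0 : ℝ) : ℂ) • translateMulti ((fun _ => (0 : EuclideanSpace ℝ (Fin 4))) k) c1)
            (fun _ => sch.m r.curvature (φ k) / 6) U
        ∂(wilsonMeasure r.ρ (sch.β (φ k)) : Measure (GaugeConfig 4 (2 * sch.L (φ k) + 1) G)))
      atTop (𝓝 (conj (planeSum T n F))) := by
    have h3 := ((Complex.continuous_conj.tendsto _).comp (tendsto_mean r sch φ T hPL hτ hδ hFτ hFδ))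
    refine h3.congr' (Eventually.of_forall fun k => ?_)
    simp only [Function.comp_apply, pow_zero, Complex.ofReal_one, one_smul, translateMulti_zero_eq, hc1, fieldObs_constOne,
      mul_one]
    rw [← integral_conj]
    exact (integral_comp_timeReflect_eq r (sch.L (φ k)) (sch.β (φ k)) _).symm
  exact tendsto_nhds_unique h1 h2

end Transfer

/-! ### Support floors of compactly supported positive-time test functions -/

/-- A compactly supported test function supported at positive times has a positive TIME FLOOR. [folklore] -/
theorem exists_time_floor {n : ℕ} {F : 𝓢((Fin n → EuclideanSpace ℝ (Fin 4)), ℂ)}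
    (hFc : HasCompactSupport (F : (Fin n → EuclideanSpace ℝ (Fin 4)) → ℂ))
    (hFp : tsupport (F : (Fin n → EuclideanSpace ℝ (Fin 4)) → ℂ) ⊆ {u | ∀ l, 0 < u l 0}) :
    ∃ τ : ℝ, 0 < τ ∧ tsupport (F : (Fin n → EuclideanSpace ℝ (Fin 4)) → ℂ) ⊆ {u | ∀ l, τ ≤ u l 0} := by
  rcases Nat.eq_zero_or_pos n with hn | hn
  · subst hn
    exact ⟨1, one_pos, fun u _ l => l.elim0⟩
  · haveI : Nonempty (Fin n) := ⟨⟨0, hn⟩⟩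
    set K := tsupport (F : (Fin n → EuclideanSpace ℝ (Fin 4)) → ℂ) with hK
    by_cases hKe : K = ∅
    · exact ⟨1, one_pos, by rw [hKe]; exact Set.empty_subset _⟩
    · set g : (Fin n → EuclideanSpace ℝ (Fin 4)) → ℝ := fun u => Finset.univ.inf' Finset.univ_nonempty fun l => u l 0
        with hg
      have hgc : Continuous g :=
        Continuous.finset_inf'_apply _ fun l _ => (EuclideanSpace.proj (0 : Fin 4)).continuous.comp (continuous_apply l)
      obtain ⟨u₀, hu₀, hmin⟩ := hFc.exists_isMinOn (Set.nonempty_iff_ne_empty.2 hKe) hgc.continuousOn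
      refine ⟨g u₀, ?_, fun u hu l => ?_⟩
      · rw [hg, Finset.lt_inf'_iff]
        exact fun l _ => (hFp hu₀) l
      · exact (hmin hu).trans (Finset.inf'_le _ (Finset.mem_univ l))

/-- A compactly supported test function is supported in a closed ball. [folklore] -/
theorem exists_radius {n : ℕ} {F : 𝓢((Fin n → EuclideanSpace ℝ (Fin 4)), ℂ)}
    (hFc : HasCompactSupport (F : (Fin n → EuclideanSpace ℝ (Fin 4)) → ℂ)) :
    ∃ ρ : ℝ, 0 ≤ ρ ∧ tsupport (F : (Fin n → EuclideanSpace ℝ (Fin 4)) → ℂ) ⊆ Metric.closedBall 0 ρ := by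
  obtain ⟨ρ, hρ, h⟩ := hFc.isCompact.isBounded.subset_closedBall_lt 0 0
  exact ⟨ρ, hρ.le, h⟩

/-- **Registered sub-goal `tendsto_mean'` (line `Sketch`, r10 decay toolkit)**: closed form of `tendsto_mean` — along a
`PlaneLimits` package the mean of the smeared renormalised functional of a separated positive-time test function converges to
the candidate family. [folklore] -/
theorem tendsto_mean' :
    ∀ (G : Type) [Group G] [TopologicalSpace G] [IsTopologicalGroup G] [CompactSpace G]
      [MeasurableSpace G] [BorelSpace G] (r : LatticeRep G) (sch : SpeciesScheme (YMSpecies G)) (φ : ℕ → ℕ)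
      (T : (n : ℕ) → (Fin n → Plane) → (𝓢((Fin n → EuclideanSpace ℝ (Fin 4)), ℂ) →L[ℂ] ℂ)),
      PlaneLimits r sch φ T → ∀ (n : ℕ) (F : 𝓢((Fin n → EuclideanSpace ℝ (Fin 4)), ℂ)) (τ δ : ℝ), 0 < τ → 0 < δ →
      tsupport (F : (Fin n → EuclideanSpace ℝ (Fin 4)) → ℂ) ⊆ {u | ∀ l, τ ≤ u l 0} →
      tsupport (F : (Fin n → EuclideanSpace ℝ (Fin 4)) → ℂ) ⊆ Separated n δ →
      Tendsto (fun k => ∫ U, fieldObs r (sch.L (φ k)) (sch.a (φ k))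
          ((((sch.c r.curvature (φ k) * sch.a (φ k) ^ 4) ^ n : ℝ) : ℂ) • F) (fun _ => sch.m r.curvature (φ k) / 6) U
        ∂(wilsonMeasure r.ρ (sch.β (φ k)) : Measure (GaugeConfig 4 (2 * sch.L (φ k) + 1) G)))
      atTop (𝓝 (planeSum T n F)) :=
  fun _ _ _ _ _ _ _ r sch φ T hPL _ _ _ _ hτ hδ hFτ hFδ => tendsto_mean r sch φ T hPL hτ hδ hFτ hFδ

end Summit.QuantumFields.YangMills.Theorems.WeakCouplingHypercubicLimit.TraceNormColdPressure

end
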